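import Summits.QuantumFields.YangMills.Theorems.BalabanUVNodesK0RecordFormatNamesIntLocalW
import Literature.Analysis.Complex.LocallyUniformLimitSCV

/-!
# NODE O port PT-A — ROWS (a)(b)(c)(d) FOR TORUS-LEVEL SERIES on the wrap class: the free pieces `Ew n X := Σ' i, T i n X` of the wrap-aware residue (DEF-1 ed.13c `TorusPieces`,
# `AnalyticOnW` ∕ `Bound118OnW` ∕ `LocalOnW` ∕ `GaugeInvOnW`) — the twin of `…PortS1Series[W]` for the WRAPPING domains, whose pieces print reads ON THE TORUS ([I] (1.7)) and which are
# the same walk ∕ polymer series with walks that may wrap ([16] (63), [II] (2.13))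

Cell `ym-nodeO-ideate`, porter seat `ymgap-nodeO-port-PTA-1` (gen 3); `--supports stmt-QuantumFields-27930` (helper).  [I] = [Balaban1987RG1], [II] = [Balaban1988RG2Cluster],
[16] = [Balaban1985UVStability3D].
* §1 (c)(d) for `Σ'` of torus pieces, UNCONDITIONALLY (termwise-equal series agree): `localOnW_tsum`, `gaugeInvOnW_tsum`.
* §2 (b) `bound118OnW_tsum` (termwise majorant on the record spaces, `tsum_of_norm_bounded`); (a) `analyticOnW_tsum` (open `O n X ⊇` record space, termwise holomorphic, summable uniform
  majorant — Weierstrass M-test SCV `Literature.Analysis.Complex.SCV.analyticOnNhd_tsum_of_summable_norm`).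
* §3 finite sums: `localOnW_finsetSum`, `gaugeInvOnW_finsetSum`, `analyticOnW_finsetSum`.

HONEST FRAMING.  Plumbing; NO series of Bałaban's is constructed or bounded; the residue is NOT proved; 27930 OPEN; K0⁷ NOT closed; NODE O 0∕1; COUNT 8∕28 · K 1∕4 UNMOVED; finite `𝕋⁴_{L^K}`
at fixed ε — NOT continuum ∕ OS ∕ Clay; **the Yang–Mills mass gap is NOT proved by any of this.**  No `sorry`, no `def`, no `instance`; standard axioms.
-/

noncomputable section

open scoped BigOperators Matrix.Norms.L2Operator Topology

namespace Summit.QuantumFields.YangMills.Theorems.BalabanUVNodesPortS1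

open Summit.QuantumFields.YangMills.Theorems.K0RecordFormatNames
open Literature.MathematicalPhysics.QuantumFieldTheory.Balaban1983to89
open Literature.MathematicalPhysics.QuantumFieldTheory.Balaban1983to89.Node00
open Literature.MathematicalPhysics.QuantumFieldTheory.Balaban1983to89.T4Continuum (T4Family)
open _root_.Filter

variable {ι : Type*} (F : T4Family)

/-! ## §1  (c)(d) for series of torus pieces, unconditionally -/

/-- **(c) for a series of torus pieces**: termwise (1.7)-locality on the sites of `X` passes to `Σ'` (no convergence needed). [cite: Balaban1987RG1, (1.7) p.261] -/
theorem localOnW_tsum {Mc k : ℕ} (T : ι → TorusPieces F Mc k) (hT : ∀ i, (T i).LocalOnW F) :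
    TorusPieces.LocalOnW F (fun n X φ => ∑' i, T i n X φ) := by
  intro n X hX φ ψ hag
  exact tsum_congr fun i => hT i n X hX φ ψ hag

/-- **(d) for a series of torus pieces**: termwise (1.19)-invariance passes to `Σ'`. [cite: Balaban1987RG1, (1.19) p.263, (1.10) p.262] -/
theorem gaugeInvOnW_tsum {Mc k : ℕ} (T : ι → TorusPieces F Mc k) (hT : ∀ i, (T i).GaugeInvOnW F) :
    TorusPieces.GaugeInvOnW F (fun n X φ => ∑' i, T i n X φ) := by
  intro n X hX u φ
  exact tsum_congr fun i => hT i n X hX u φ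

/-! ## §2  (b) and (a) for series of torus pieces -/

/-- **(b) for a series of torus pieces**: termwise bounds `‖T i n X φ‖ ≤ u i n X` on the record space of a wrap-class domain, a majorant series `HasSum (u · n X) (U n X)` and
`U n X ≤ E₀e^{−κ d(X)}` give `Bound118OnW` for `Σ' i, T i` (comparison with the majorant). [cite: Balaban1987RG1, (1.18) p.263; Balaban1985UVStability3D, (23)–(25) p.262; Balaban1988RG2Cluster, (2.41) p.21] -/
theorem bound118OnW_tsum {Mc k : ℕ} (α₀ α₁ E₀ κ : ℝ) (T : ι → TorusPieces F Mc k)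
    (u : ι → (n : ℕ) → (recordDomSys F Mc k (recordK₀ F Mc k + n)).Dom → ℝ)
    (U : (n : ℕ) → (recordDomSys F Mc k (recordK₀ F Mc k + n)).Dom → ℝ)
    (hb : ∀ i n (X : (recordDomSys F Mc k (recordK₀ F Mc k + n)).Dom), X ∈ recordWrapCtr F Mc k (recordK₀ F Mc k + n) →
      ∀ φ : Sect2.CPair (F.P (recordK₀ F Mc k + n)) (MatA 2),
        encodeCfg F (recordK₀ F Mc k + n) φ ∈ recordUc F Mc k α₀ α₁ (recordK₀ F Mc k + n) X → ‖T i n X φ‖ ≤ u i n X)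
    (hu : ∀ n X, X ∈ recordWrapCtr F Mc k (recordK₀ F Mc k + n) → HasSum (fun i => u i n X) (U n X))
    (hU : ∀ n X, X ∈ recordWrapCtr F Mc k (recordK₀ F Mc k + n) → U n X ≤ E₀ * Real.exp (-κ * (recordDomSys F Mc k (recordK₀ F Mc k + n)).dj X)) :
    TorusPieces.Bound118OnW F (fun n X φ => ∑' i, T i n X φ) α₀ α₁ E₀ κ := by
  intro n X hX φ hφ
  exact (tsum_of_norm_bounded (hu n X hX) fun i => hb i n X hX φ hφ).trans (hU n X hX)

/-- **(a) for a series of torus pieces** (Weierstrass M-test, several complex variables): for a wrap-class domain `X`, an OPEN set `O n X ⊇` its record space on which every term is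
`ℂ`-differentiable with a summable uniform majorant ⟹ `AnalyticOnW` for `Σ' i, T i`. [cite: Balaban1987RG1, p.263 («analytic on the space U^c_j»); Balaban1988RG2Cluster, (2.41) p.21] -/
theorem analyticOnW_tsum {Mc k : ℕ} (α₀ α₁ : ℝ) (T : ι → TorusPieces F Mc k)
    (O : (n : ℕ) → (recordDomSys F Mc k (recordK₀ F Mc k + n)).Dom → Set (Sect2.CPair (F.P (recordK₀ F Mc k + n)) (MatA 2)))
    (hO : ∀ n X, X ∈ recordWrapCtr F Mc k (recordK₀ F Mc k + n) → IsOpen (O n X))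
    (hUcO : ∀ n (X : (recordDomSys F Mc k (recordK₀ F Mc k + n)).Dom), X ∈ recordWrapCtr F Mc k (recordK₀ F Mc k + n) →
      ∀ φ : Sect2.CPair (F.P (recordK₀ F Mc k + n)) (MatA 2),
        encodeCfg F (recordK₀ F Mc k + n) φ ∈ recordUc F Mc k α₀ α₁ (recordK₀ F Mc k + n) X → φ ∈ O n X)
    (hd : ∀ i n X, X ∈ recordWrapCtr F Mc k (recordK₀ F Mc k + n) → DifferentiableOn ℂ (T i n X) (O n X))
    (u : ι → (n : ℕ) → (recordDomSys F Mc k (recordK₀ F Mc k + n)).Dom → ℝ)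
    (hu : ∀ n X, X ∈ recordWrapCtr F Mc k (recordK₀ F Mc k + n) → Summable (fun i => u i n X))
    (hb : ∀ i n X, X ∈ recordWrapCtr F Mc k (recordK₀ F Mc k + n) → ∀ φ ∈ O n X, ‖T i n X φ‖ ≤ u i n X) :
    TorusPieces.AnalyticOnW F (fun n X φ => ∑' i, T i n X φ) α₀ α₁ := by
  intro n X hX φ hφ
  have hA := Literature.Analysis.Complex.SCV.analyticOnNhd_tsum_of_summable_norm (hO n X hX) (fun i => hd i n X hX) (hu n X hX)
    (fun i ψ hψ => hb i n X hX ψ hψ)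
  exact hA φ (hUcO n X hX φ hφ)

/-! ## §3  Finite sums of torus pieces -/

/-- (c) for a finite sum of torus pieces. [cite: Balaban1987RG1, (1.7) p.261 (bookkeeping)] -/
theorem localOnW_finsetSum {Mc k : ℕ} (T : ι → TorusPieces F Mc k) (hT : ∀ i, (T i).LocalOnW F) (S : Finset ι) :
    TorusPieces.LocalOnW F (fun n X φ => ∑ i ∈ S, T i n X φ) := by
  intro n X hX φ ψ hag
  exact Finset.sum_congr rfl fun i _ => hT i n X hX φ ψ hag

/-- (d) for a finite sum of torus pieces. [cite: Balaban1987RG1, (1.19) p.263 (bookkeeping)] -/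
theorem gaugeInvOnW_finsetSum {Mc k : ℕ} (T : ι → TorusPieces F Mc k) (hT : ∀ i, (T i).GaugeInvOnW F) (S : Finset ι) :
    TorusPieces.GaugeInvOnW F (fun n X φ => ∑ i ∈ S, T i n X φ) := by
  intro n X hX u φ
  exact Finset.sum_congr rfl fun i _ => hT i n X hX u φ

/-- (a) for a finite sum of torus pieces (no majorant needed). [cite: Balaban1987RG1, p.263 (bookkeeping)] -/
theorem analyticOnW_finsetSum {Mc k : ℕ} (α₀ α₁ : ℝ) (T : ι → TorusPieces F Mc k) (S : Finset ι)
    (O : (n : ℕ) → (recordDomSys F Mc k (recordK₀ F Mc k + n)).Dom → Set (Sect2.CPair (F.P (recordK₀ F Mc k + n)) (MatA 2)))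
    (hO : ∀ n X, X ∈ recordWrapCtr F Mc k (recordK₀ F Mc k + n) → IsOpen (O n X))
    (hUcO : ∀ n (X : (recordDomSys F Mc k (recordK₀ F Mc k + n)).Dom), X ∈ recordWrapCtr F Mc k (recordK₀ F Mc k + n) →
      ∀ φ : Sect2.CPair (F.P (recordK₀ F Mc k + n)) (MatA 2),
        encodeCfg F (recordK₀ F Mc k + n) φ ∈ recordUc F Mc k α₀ α₁ (recordK₀ F Mc k + n) X → φ ∈ O n X)
    (hd : ∀ i ∈ S, ∀ n X, X ∈ recordWrapCtr F Mc k (recordK₀ F Mc k + n) → DifferentiableOn ℂ (T i n X) (O n X)) :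
    TorusPieces.AnalyticOnW F (fun n X φ => ∑ i ∈ S, T i n X φ) α₀ α₁ := by
  intro n X hX φ hφ
  have hdS : DifferentiableOn ℂ (fun ψ => ∑ i ∈ S, T i n X ψ) (O n X) := DifferentiableOn.fun_sum fun i hi => hd i hi n X hX
  exact (Literature.Analysis.Complex.SCV.analyticOnNhd_of_differentiableOn hdS (hO n X hX)) φ (hUcO n X hX φ hφ)

end Summit.QuantumFields.YangMills.Theorems.BalabanUVNodesPortS1

end
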